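import Summits.QuantumFields.YangMills.Theorems.PencilRigidityDiagonalMirrorRPRStubRpClosureDefs

/-!
# Crux `DiagonalMirrorRPR` (stmt-QuantumFields-10604), line `kms-variance-lukewarm-descent`, lever
# `stub_secondMomentLever`: vocabulary of the `e₀`-slicing of Wilson's unsheared box tori

Routes `PencilRigidity` / `MirrorModularBoosts` of `YangMills`, crux `DiagonalMirrorRPR`.  The lever of the line
(`DoublingStep ∧ TwistStep`, kms stubs 3 ∧ 4) rests on the transfer-matrix realisation of Wilson's measure on the
unsheared box tori `TConfig M n₁ N` (`…StubRpClosureDefs`: sites `ZMod M × ZMod n₁ × ZMod N × ZMod N`, action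
`taction ρ false`, weight `tweight`, product Haar `thaar`, partition function `tZ ρ M n₁ N β false`) sliced along
coordinate `0` ("time", `M` slices).  This module fixes that vocabulary (Lüscher 1977; Osterwalder–Seiler 1978 §2):

* `SSite n₁ N` — the sites of one time slice (`TSite M n₁ N = ZMod M × SSite n₁ N` definitionally); `sstep j` the three
  spatial unit steps; `SliceCfg n₁ N G = SSite × Fin 3 → G` the spatial link variables of one slice (direction
  `j.succ`), `TempCfg n₁ N G = SSite → G` the temporal link variables leaving one slice;
* `sliceEquiv M n₁ N : TConfig M n₁ N G ≃ᵐ (Fin M → SliceCfg) × (Fin M → TempCfg)` — reading a box configuration slice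
  by slice (time `t : Fin M` is sent to `ZMod.finEquiv M t`);
* `spatialAction ρ u`, `temporalAction ρ u g u'` — Wilson's plaquette sum inside a slice / between consecutive slices;
* `sliceWeight ρ β u = exp(β/2 · spatialAction)`, `temporalKernel ρ β u u' = ∫ exp(β · temporalAction u g u') dg` and the
  TRANSFER KERNEL `transferKernel ρ β u u' = sliceWeight u · temporalKernel u u' · sliceWeight u'` on `SliceCfg`, whose
  cyclic integrals are the box-torus partition functions (`…SliceTransfer`: `tZ = ∫ ∏ₜ K(V t, V (t+1))`).

References: M. Lüscher, Comm. Math. Phys. 54 (1977) 283; K. Osterwalder, E. Seiler, Ann. Phys. 110 (1978) 440, §2;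
E. Seiler, LNP 159 (1982), Ch. 2.
-/

set_option autoImplicit false

noncomputable section

open MeasureTheory
open Literature.MathematicalPhysics.QuantumLattice Literature.MathematicalPhysics.QuantumFieldTheory

namespace Summit.QuantumFields.YangMills.Cruxes.DiagonalMirrorRPR.KmsVarianceLukewarmDescent

open ParityBridgeColdTraces

/-! ## §1 Slices of the unsheared box torus -/

/-- Sites of one time slice: `ZMod n₁ × ZMod N × ZMod N` (so that `TSite M n₁ N = ZMod M × SSite n₁ N`). -/
abbrev SSite (n₁ N : ℕ) : Type := ZMod n₁ × ZMod N × ZMod N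

/-- The three spatial unit steps of a slice (directions `1, 2, 3` of the box). -/
def sstep {n₁ N : ℕ} (j : Fin 3) : SSite n₁ N :=
  ![((1 : ZMod n₁), (0 : ZMod N), (0 : ZMod N)), ((0 : ZMod n₁), (1 : ZMod N), (0 : ZMod N)),
    ((0 : ZMod n₁), (0 : ZMod N), (1 : ZMod N))] j

/-- Spatial link variables of one slice: a group element per site and spatial direction `j.succ`. -/
abbrev SliceCfg (n₁ N : ℕ) (G : Type*) : Type _ := SSite n₁ N × Fin 3 → G

/-- Temporal link variables leaving one slice: a group element per site. -/
abbrev TempCfg (n₁ N : ℕ) (G : Type*) : Type _ := SSite n₁ N → G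

section Equiv

variable {M n₁ N : ℕ} [NeZero M] {G : Type*}

/-- Reading a box configuration slice by slice: spatial links `((τ, s), j.succ)` and temporal links `((τ, s), 0)` of
the slice `τ = ZMod.finEquiv M t`. -/
def sliceRead (U : TConfig M n₁ N G) : (Fin M → SliceCfg n₁ N G) × (Fin M → TempCfg n₁ N G) :=
  (fun t p => U ((ZMod.finEquiv M t, p.1), p.2.succ), fun t s => U ((ZMod.finEquiv M t, s), 0))

/-- Assembling a box configuration from its slices. -/
def sliceAssemble (V : (Fin M → SliceCfg n₁ N G) × (Fin M → TempCfg n₁ N G)) : TConfig M n₁ N G :=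
  fun e => Fin.cases (V.2 ((ZMod.finEquiv M).symm e.1.1) e.1.2)
    (fun j => V.1 ((ZMod.finEquiv M).symm e.1.1) (e.1.2, j)) e.2

/-- `sliceAssemble ∘ sliceRead = id`. -/
theorem sliceAssemble_sliceRead (U : TConfig M n₁ N G) : sliceAssemble (sliceRead U) = U := by
  funext ⟨⟨τ, s⟩, i⟩
  refine Fin.cases ?_ (fun j => ?_) i
  · simp [sliceAssemble, sliceRead]
  · simp [sliceAssemble, sliceRead]

/-- `sliceRead ∘ sliceAssemble = id`. -/
theorem sliceRead_sliceAssemble (V : (Fin M → SliceCfg n₁ N G) × (Fin M → TempCfg n₁ N G)) :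
    sliceRead (sliceAssemble V) = V := by
  rcases V with ⟨u, g⟩
  simp only [sliceRead, sliceAssemble, Prod.mk.injEq]
  refine ⟨?_, ?_⟩
  · funext t ⟨s, j⟩
    simp
  · funext t s
    simp

variable [MeasurableSpace G]

/-- Reading slices is measurable (coordinate projections). -/
theorem measurable_sliceRead : Measurable (sliceRead : TConfig M n₁ N G → _) := by
  refine Measurable.prodMk ?_ ?_
  · exact measurable_pi_lambda _ fun t => measurable_pi_lambda _ fun p => measurable_pi_apply _
  · exact measurable_pi_lambda _ fun t => measurable_pi_lambda _ fun s => measurable_pi_apply _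

/-- Assembling slices is measurable (coordinate projections, after a case split on the direction). -/
theorem measurable_sliceAssemble :
    Measurable (sliceAssemble : (Fin M → SliceCfg n₁ N G) × (Fin M → TempCfg n₁ N G) → TConfig M n₁ N G) := by
  refine measurable_pi_lambda _ fun e => ?_
  obtain ⟨⟨τ, s⟩, i⟩ := e
  refine Fin.cases ?_ (fun j => ?_) i
  · simp only [sliceAssemble, Fin.cases_zero]
    exact (measurable_pi_apply s).comp ((measurable_pi_apply _).comp measurable_snd)
  · simp only [sliceAssemble, Fin.cases_succ]
    exact (measurable_pi_apply (s, j)).comp ((measurable_pi_apply _).comp measurable_fst)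

variable (M n₁ N G) in
/-- **The slicing equivalence** `TConfig M n₁ N G ≃ᵐ (Fin M → SliceCfg n₁ N G) × (Fin M → TempCfg n₁ N G)`. -/
def sliceEquiv : TConfig M n₁ N G ≃ᵐ (Fin M → SliceCfg n₁ N G) × (Fin M → TempCfg n₁ N G) where
  toFun := sliceRead
  invFun := sliceAssemble
  left_inv := sliceAssemble_sliceRead
  right_inv := sliceRead_sliceAssemble
  measurable_toFun := measurable_sliceRead
  measurable_invFun := measurable_sliceAssemble

/-- The slicing equivalence reads slices. -/
@[simp] theorem sliceEquiv_apply (U : TConfig M n₁ N G) : sliceEquiv M n₁ N G U = sliceRead U := rfl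

/-- Its inverse assembles slices. -/
@[simp] theorem sliceEquiv_symm_apply (V : (Fin M → SliceCfg n₁ N G) × (Fin M → TempCfg n₁ N G)) :
    (sliceEquiv M n₁ N G).symm V = sliceAssemble V := rfl

end Equiv

/-! ## §2 Wilson's action inside a slice and between consecutive slices; the transfer kernel -/

section Action

variable {n₁ N : ℕ} [NeZero n₁] [NeZero N] {G : Type*} [Group G] {Nc : ℕ} (ρ : G →* Matrix (Fin Nc) (Fin Nc) ℂ)

/-- The spatial plaquette `(s; j, k)` of a slice: `u(s,j) u(s+ĵ,k) u(s+k̂,j)⁻¹ u(s,k)⁻¹`. -/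
def spatialPlaq (u : SliceCfg n₁ N G) (s : SSite n₁ N) (j k : Fin 3) : G :=
  u (s, j) * u (s + sstep j, k) * (u (s + sstep k, j))⁻¹ * (u (s, k))⁻¹

/-- Wilson's plaquette sum INSIDE a slice: `∑ₛ ∑_{j<k} Re tr ρ(spatial plaquette)`. -/
def spatialAction (u : SliceCfg n₁ N G) : ℝ :=
  ∑ s : SSite n₁ N, ∑ j : Fin 3, ∑ k : Fin 3, if j < k then (ρ (spatialPlaq u s j k)).trace.re else 0

/-- The temporal plaquette `(s; 0, j.succ)` between a slice `u` (temporal links `g`) and the next slice `u'`: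
`g(s) u'(s,j) g(s+ĵ)⁻¹ u(s,j)⁻¹` (= `tplaq false U (τ,s) 0 j.succ`). -/
def temporalPlaq (u : SliceCfg n₁ N G) (g : TempCfg n₁ N G) (u' : SliceCfg n₁ N G) (s : SSite n₁ N) (j : Fin 3) : G :=
  g s * u' (s, j) * (g (s + sstep j))⁻¹ * (u (s, j))⁻¹

/-- Wilson's plaquette sum BETWEEN consecutive slices: `∑ₛ ∑ⱼ Re tr ρ(temporal plaquette)`. -/
def temporalAction (u : SliceCfg n₁ N G) (g : TempCfg n₁ N G) (u' : SliceCfg n₁ N G) : ℝ :=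
  ∑ s : SSite n₁ N, ∑ j : Fin 3, (ρ (temporalPlaq u g u' s j)).trace.re

/-- Half the Boltzmann weight of a slice: `exp((β/2) · spatialAction)`. -/
def sliceWeight (β : ℝ) (u : SliceCfg n₁ N G) : ℝ :=
  Real.exp (β / 2 * spatialAction ρ u)

variable [TopologicalSpace G] [IsTopologicalGroup G] [CompactSpace G] [MeasurableSpace G] [BorelSpace G]

/-- The temporal kernel: the Boltzmann weight of the plaquettes between two consecutive slices, with the temporal
link variables integrated out (product Haar measure). -/
def temporalKernel (β : ℝ) (u u' : SliceCfg n₁ N G) : ℝ :=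
  ∫ g, Real.exp (β * temporalAction ρ u g u') ∂(Measure.pi fun _ : SSite n₁ N => haarProbability G)

/-- **The transfer kernel of Wilson's action on the slice configurations** (Lüscher; Osterwalder–Seiler):
`K(u, u') = w(u) k(u, u') w(u')`, symmetric in `u, u'`; its `M`-fold cyclic integral is the partition function of the
box torus with `M` slices (`…SliceTransfer`). -/
def transferKernel (β : ℝ) (u u' : SliceCfg n₁ N G) : ℝ :=
  sliceWeight ρ β u * temporalKernel ρ β u u' * sliceWeight ρ β u'

/-- **Registered sub-goal `stub_sliceRead_assemble` (the slicing is a genuine equivalence: assembling the slices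
read off a box configuration returns the configuration).** -/
theorem stub_sliceRead_assemble :
    ∀ {M n₁ N : ℕ} [NeZero M] {G : Type} (U : TConfig M n₁ N G), sliceAssemble (sliceRead U) = U :=
  fun U => sliceAssemble_sliceRead U

end Action


/-! ## §3 The spatial gauge action and the link coupling (appended for the positivity of the transfer kernel) -/

section Gauge

variable {n₁ N : ℕ} [NeZero n₁] [NeZero N] {G : Type*} [Group G] {Nc : ℕ} (ρ : G →* Matrix (Fin Nc) (Fin Nc) ℂ)

/-- The gauge transformation of the spatial links of a slice by site variables `h`:
`(h • u)(s, j) = h(s) u(s, j) h(s + ĵ)⁻¹`.  With `h = g` (the temporal links) it turns the temporal plaquette into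
a bare link coupling: `temporalPlaq u g u' s j = (sgauge g u')(s, j) · u(s, j)⁻¹`. -/
def sgauge (h : TempCfg n₁ N G) (u : SliceCfg n₁ N G) : SliceCfg n₁ N G :=
  fun p => h p.1 * u p * (h (p.1 + sstep p.2))⁻¹

/-- The bare link coupling of two slice configurations: `∑_{s,j} Re tr ρ(v(s,j) u(s,j)⁻¹)` — for unitary `ρ` the
real Hilbert–Schmidt pairing `∑ Re tr[ρ(v_ℓ) ρ(u_ℓ)†]` of the feature vectors `(ρ(u_ℓ))_ℓ`, a Gram kernel; Wilson's
temporal action is `temporalAction ρ u g u' = linkCoupling ρ u (sgauge g u')`. -/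
def linkCoupling (u v : SliceCfg n₁ N G) : ℝ :=
  ∑ p : SSite n₁ N × Fin 3, (ρ (v p * (u p)⁻¹)).trace.re

/-- **Wilson's temporal action is the link coupling with the gauge-transformed next slice.** -/
theorem temporalAction_eq_linkCoupling (u : SliceCfg n₁ N G) (g : TempCfg n₁ N G) (u' : SliceCfg n₁ N G) :
    temporalAction ρ u g u' = linkCoupling ρ u (sgauge g u') := by
  unfold temporalAction linkCoupling temporalPlaq sgauge
  exact (Fintype.sum_prod_type' fun s j => (ρ (g s * u' (s, j) * (g (s + sstep j))⁻¹ * (u (s, j))⁻¹)).trace.re).symm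

end Gauge

end Summit.QuantumFields.YangMills.Cruxes.DiagonalMirrorRPR.KmsVarianceLukewarmDescent

end
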